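import Summits.AnomalousDissipation.AnomalousDissipation.Theorems.SolenoidalFractalHomogenisationLagrangianCarrierConstructionRegularLSupBound
import Summits.AnomalousDissipation.AnomalousDissipation.Theorems.SolenoidalFractalHomogenisationLagrangianCarrierChainRule
import HarnessLib

/-!
# K3L `LagrangianCarrierConstruction` (stmt-AnomalousDissipation-24913), line `birth`, stub `stub_regularL`: the WINDOW CONJUGATION IDENTITY
# of the Lagrangian flows of an abstract Lagrangian carrier (helper; `--supports stmt-AnomalousDissipation-24913`)

Summits-side helper file (everything proved; no definitions, no named facts). For the abstract carrier `E` of `stub_regularL` (`IsLagrangian` +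
the qualitative clauses (L1), (L3a), (L3b), (F1a), (F1b)) write `Φ_m(s→t) = evolutionMap B_m s t` for the evolution maps of the lifted coarse
field `B_m(t, z) = (b 1 + ⋯ + b m)(t, proj z)` — these ARE the lifted flows `X m t s`, `Φ_m(s→t) = id + lift (disp m t s)`
(`…RegularLSupBound.lift_disp_eq_evolutionMap_sub`), with derivative `flowDeriv m t s` (`fderiv_evolutionMap_partialSum`) — and `Ψ_{m+1}(s→t)`
for those of the lifted Eulerian level `v_{m+1}(t, z) = level (m+1) t (proj z)`. `IsInserted` says that on the refresh window `[w, w + R_{m+1})`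
the level `b (m+1)` is `v_{m+1}` pushed forward by `Φ_m(w→·)` (`b_succ_proj_evolutionMap`). CONSEQUENCE (`evolutionMap_partialSum_succ_eq_conj`):
for `s, t` in one window of level `m+1`,

  `Φ_{m+1}(s→t) = Φ_m(w→t) ∘ Ψ_{m+1}(s→t) ∘ Φ_m(s→w)`

— the flow of `b_{≤m} + (Φ_m)_* v_{m+1}` is the coarse flow CONJUGATING the Eulerian flow of the fine level (interaction picture): the curve
`r ↦ Φ_m(w→r)(Ψ(s→r)(Φ_m(s→w) z))` solves `γ' = B_{m+1}(r, γ)` (mixed chain rule `…LagrangianCarrier.hasDerivAt_comp_curve`, no joint `C¹`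
needed) and ODE uniqueness within the window (`IsUniformlyLipschitzOn.eq_evolutionMap`). This identity is what makes the second-order distortion
tower of the carrier close WITHOUT derivative loss (the `n`-th derivative of `Φ_{m+1}` involves only `n` derivatives of `Φ_m` and of the explicit
`Ψ`). Also: the windows of level `m+2` nest in those of level `m+1` (`exists_window_succ_subset`, clause (W2)).
[cite: ArmstrongVicol2025, §2.2 (PDF pp. 12, 18: X_m the flow of b_{≤m}; b_m inserted in the Lagrangian coordinates of b_{m−1}, windows nested) and §5.1]
Infrastructure for route-1's rung leaf F-D1.A0 (a frontier FORMAL rung); NOT a proof of anomalous dissipation.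
-/

set_option linter.dupNamespace false

noncomputable section

namespace Summit.AnomalousDissipation.AnomalousDissipation.Theorems.SolenoidalFractalHomogenisation.LagrangianCarrierConstruction

open Set Function Filter Topology MeasureTheory
open scoped NNReal ContDiff
open Literature.Analysis Literature.Analysis.ODE Literature.Analysis.FunctionSpaces Literature.Analysis.FunctionSpaces.Torus
open Literature.Analysis.FluidPDE Literature.Analysis.FluidPDE.LatticeShear

variable {k : ℕ}

/-! ## Nesting of the refresh windows -/

/-- **(W2) ⇒ nested windows**: every window of level `m+2` lies in a window of level `m+1`.
[cite: ArmstrongVicol2025, §2.2 (PDF p. 12: τ″_m an integer multiple of τ″_{m+1})] -/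
theorem exists_window_succ_subset (E : LagrangianLatticeCarrier k)
    (hW2 : ∀ m, ∃ q : ℕ, 0 < q ∧ E.refresh m = (q : ℝ) * E.refresh (m + 1)) (m : ℕ) (j : ℤ) :
    ∃ j' : ℤ, E.window (m + 2) j ⊆ E.window (m + 1) j' := by
  obtain ⟨q, hq, hqR⟩ := hW2 (m + 1)
  have hR := E.refresh_pos (m + 2)
  have hq' : (0 : ℝ) < q := by exact_mod_cast hq
  refine ⟨⌊(j : ℝ) / q⌋, fun t ht => ?_⟩
  set j' : ℤ := ⌊(j : ℝ) / q⌋ with hj'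
  have h1 : (j' : ℝ) * q ≤ j := by
    have := Int.floor_le ((j : ℝ) / q)
    rwa [le_div_iff₀ hq'] at this
  have h2 : (j : ℤ) + 1 ≤ (j' + 1) * q := by
    have h : (j : ℝ) / q < (j' : ℝ) + 1 := Int.lt_floor_add_one _
    rw [div_lt_iff₀ hq'] at h
    have h' : (j : ℤ) < (j' + 1) * q := by exact_mod_cast h
    omega
  have h2' : ((j : ℝ) + 1) ≤ ((j' : ℝ) + 1) * q := by exact_mod_cast h2
  obtain ⟨ht1, ht2⟩ := ht
  unfold LagrangianLatticeCarrier.window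
  rw [show m + 1 + 1 = m + 2 from rfl] at hqR
  refine ⟨?_, ?_⟩
  · calc (j' : ℝ) * E.refresh (m + 1) = (j' : ℝ) * q * E.refresh (m + 2) := by rw [hqR]; ring
      _ ≤ (j : ℝ) * E.refresh (m + 2) := mul_le_mul_of_nonneg_right h1 hR.le
      _ ≤ t := ht1
  · calc t < ((j : ℝ) + 1) * E.refresh (m + 2) := ht2
      _ ≤ ((j' : ℝ) + 1) * q * E.refresh (m + 2) := mul_le_mul_of_nonneg_right h2' hR.le
      _ = ((j' : ℝ) + 1) * E.refresh (m + 1) := by rw [hqR]; ring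

/-- Two times in one window are closer than the window length. [folklore] -/
theorem abs_sub_lt_refresh_of_mem_window (E : LagrangianLatticeCarrier k) (m : ℕ) (j : ℤ) {s t : ℝ}
    (hs : s ∈ E.window m j) (ht : t ∈ E.window m j) : |t - s| < E.refresh m := by
  obtain ⟨hs1, hs2⟩ := hs
  obtain ⟨ht1, ht2⟩ := ht
  rw [abs_lt]
  constructor <;> nlinarith

/-- The left end of a window belongs to it. [folklore] -/
theorem left_mem_window (E : LagrangianLatticeCarrier k) (m : ℕ) (j : ℤ) : (j : ℝ) * E.refresh m ∈ E.window m j :=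
  ⟨le_rfl, by nlinarith [E.refresh_pos m]⟩

/-! ## The Lagrangian flows as evolution maps -/

/-- The evolution map of the lifted coarse field, read through the displacement: `Φ_m(s→t)(y) = y + disp m t s (proj y)`.
[cite: ArmstrongVicol2025, §2.2 (PDF p. 18: the flows X_m of b_{≤m})] -/
theorem evolutionMap_partialSum_apply (E : LagrangianLatticeCarrier k) (m : ℕ) (hflow : E.IsFlow m)
    (h1 : ∀ m, Continuous (uncurry (E.b (m + 1)))) (h3a : ∀ m t, IsSmooth (E.b (m + 1) t))
    (h3b : ∀ m (n : ℕ), ∃ C : ℝ, ∀ t y, ‖iteratedFDeriv ℝ n (Torus.lift (E.b (m + 1) t)) y‖ ≤ C)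
    (hF1a : ∀ m s, Continuous fun p : ℝ × UnitAddTorus (Fin 3) => E.disp m p.1 s p.2) (s t : ℝ) (y : EuclideanSpace ℝ (Fin 3)) :
    evolutionMap (fun t (z : EuclideanSpace ℝ (Fin 3)) => E.partialSum m t (proj z)) s t y = y + E.disp m t s (proj y) := by
  have h := congrFun (lift_disp_eq_evolutionMap_sub E m hflow h1 h3a h3b hF1a t s) y
  rw [Torus.lift_apply] at h
  rw [h]; abel

/-- The evolution maps of the lifted coarse field are differentiable (clause (F1b)). [folklore] -/
theorem differentiable_evolutionMap_partialSum (E : LagrangianLatticeCarrier k) (m : ℕ) (hflow : E.IsFlow m)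
    (h1 : ∀ m, Continuous (uncurry (E.b (m + 1)))) (h3a : ∀ m t, IsSmooth (E.b (m + 1) t))
    (h3b : ∀ m (n : ℕ), ∃ C : ℝ, ∀ t y, ‖iteratedFDeriv ℝ n (Torus.lift (E.b (m + 1) t)) y‖ ≤ C)
    (hF1a : ∀ m s, Continuous fun p : ℝ × UnitAddTorus (Fin 3) => E.disp m p.1 s p.2)
    (hF1b : ∀ m t s, IsSmooth (E.disp m t s)) (s t : ℝ) :
    Differentiable ℝ (evolutionMap (fun t (z : EuclideanSpace ℝ (Fin 3)) => E.partialSum m t (proj z)) s t) := by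
  have e : evolutionMap (fun t (z : EuclideanSpace ℝ (Fin 3)) => E.partialSum m t (proj z)) s t =
      fun y => y + Torus.lift (E.disp m t s) y := by
    funext y; rw [evolutionMap_partialSum_apply E m hflow h1 h3a h3b hF1a, Torus.lift_apply]
  rw [e]
  exact differentiable_id.add ((hF1b m t s).differentiable (by simp))

/-- **The derivative of the evolution map is `flowDeriv`**: `D Φ_m(s→t)(y) = flowDeriv m t s (proj y)`.
[cite: ArmstrongVicol2025, §2.2 (PDF p. 18: ∇X_{m−1})] -/
theorem fderiv_evolutionMap_partialSum (E : LagrangianLatticeCarrier k) (m : ℕ) (hflow : E.IsFlow m)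
    (h1 : ∀ m, Continuous (uncurry (E.b (m + 1)))) (h3a : ∀ m t, IsSmooth (E.b (m + 1) t))
    (h3b : ∀ m (n : ℕ), ∃ C : ℝ, ∀ t y, ‖iteratedFDeriv ℝ n (Torus.lift (E.b (m + 1) t)) y‖ ≤ C)
    (hF1a : ∀ m s, Continuous fun p : ℝ × UnitAddTorus (Fin 3) => E.disp m p.1 s p.2)
    (hF1b : ∀ m t s, IsSmooth (E.disp m t s)) (s t : ℝ) (y : EuclideanSpace ℝ (Fin 3)) :
    fderiv ℝ (evolutionMap (fun t (z : EuclideanSpace ℝ (Fin 3)) => E.partialSum m t (proj z)) s t) y = E.flowDeriv m t s (proj y) := by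
  have hB := isUniformlyLipschitzOn_partialSum_proj E h1 h3a h3b m
  set F := evolutionMap (fun t (z : EuclideanSpace ℝ (Fin 3)) => E.partialSum m t (proj z)) s t with hF
  have e : F = fun y => y + Torus.lift (E.disp m t s) y := by
    funext y; rw [hF, evolutionMap_partialSum_apply E m hflow h1 h3a h3b hF1a, Torus.lift_apply]
  have hdiff : Differentiable ℝ (Torus.lift (E.disp m t s)) := (hF1b m t s).differentiable (by simp)
  have hDF : ∀ z, fderiv ℝ F z = ContinuousLinearMap.id ℝ _ + fderiv ℝ (Torus.lift (E.disp m t s)) z := fun z => by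
    rw [e, fderiv_fun_add differentiableAt_fun_id (hdiff z), fderiv_fun_id]
  -- periodicity: the derivative of the equivariant `F` at `repr (proj y) = y + n` equals that at `y`
  obtain ⟨n, hn⟩ := exists_repr_proj_eq_add_latticeVec_holds y
  have hFeq : ∀ z (k : Fin 3 → ℤ), F (z + latticeVec k) = F z + latticeVec k := fun z k =>
    evolutionMap_add_latticeVec hB (partialSum_proj_add_latticeVec E m) s t z k
  unfold LagrangianLatticeCarrier.flowDeriv
  rw [hn]
  have h := fderiv_add_latticeVec_of_equivariant hFeq y n
  rw [hDF, hDF] at h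
  rw [hDF]
  exact h.symm

/-- The evolution `(r, y) ↦ Φ_m(w→r)(y)` is jointly continuous (clause (F1a)). [folklore] -/
theorem continuous_evolutionMap_partialSum_uncurry (E : LagrangianLatticeCarrier k) (m : ℕ) (hflow : E.IsFlow m)
    (h1 : ∀ m, Continuous (uncurry (E.b (m + 1)))) (h3a : ∀ m t, IsSmooth (E.b (m + 1) t))
    (h3b : ∀ m (n : ℕ), ∃ C : ℝ, ∀ t y, ‖iteratedFDeriv ℝ n (Torus.lift (E.b (m + 1) t)) y‖ ≤ C)
    (hF1a : ∀ m s, Continuous fun p : ℝ × UnitAddTorus (Fin 3) => E.disp m p.1 s p.2) (w : ℝ) :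
    Continuous fun p : ℝ × EuclideanSpace ℝ (Fin 3) =>
      evolutionMap (fun t (z : EuclideanSpace ℝ (Fin 3)) => E.partialSum m t (proj z)) w p.1 p.2 := by
  have e : (fun p : ℝ × EuclideanSpace ℝ (Fin 3) =>
      evolutionMap (fun t (z : EuclideanSpace ℝ (Fin 3)) => E.partialSum m t (proj z)) w p.1 p.2) =
      fun p => p.2 + E.disp m p.1 w (proj p.2) := by
    funext p; rw [evolutionMap_partialSum_apply E m hflow h1 h3a h3b hF1a]
  rw [e]
  exact continuous_snd.add ((hF1a m w).comp (continuous_fst.prodMk (continuous_proj.comp continuous_snd)))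

/-! ## The insertion, lifted -/

/-- **`IsInserted` on the lifted flow**: for `t` in the window `[w, w + R_{m+1})`, `w = j R_{m+1}`,
`b (m+1) t (proj (Φ_m(w→t) y)) = D Φ_m(w→t)(y) · v_{m+1}(t, y)` for every `y ∈ ℝ³`.
[cite: ArmstrongVicol2025, §2.2 (PDF p. 18: b_m − b_{m−1} = ∇X_{m−1} v_m ∘ X_{m−1}^{-1} on the windows)] -/
theorem b_succ_proj_evolutionMap (E : LagrangianLatticeCarrier k) (m : ℕ) (hL : E.IsLagrangian)
    (h1 : ∀ m, Continuous (uncurry (E.b (m + 1)))) (h3a : ∀ m t, IsSmooth (E.b (m + 1) t))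
    (h3b : ∀ m (n : ℕ), ∃ C : ℝ, ∀ t y, ‖iteratedFDeriv ℝ n (Torus.lift (E.b (m + 1) t)) y‖ ≤ C)
    (hF1a : ∀ m s, Continuous fun p : ℝ × UnitAddTorus (Fin 3) => E.disp m p.1 s p.2)
    (hF1b : ∀ m t s, IsSmooth (E.disp m t s)) (j : ℤ) {t : ℝ} (ht : t ∈ E.window (m + 1) j)
    (y : EuclideanSpace ℝ (Fin 3)) :
    E.b (m + 1) t (proj (evolutionMap (fun t (z : EuclideanSpace ℝ (Fin 3)) => E.partialSum m t (proj z))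
        ((j : ℝ) * E.refresh (m + 1)) t y)) =
      fderiv ℝ (evolutionMap (fun t (z : EuclideanSpace ℝ (Fin 3)) => E.partialSum m t (proj z)) ((j : ℝ) * E.refresh (m + 1)) t) y
        (E.toFractalCarrierData.level (m + 1) t (proj y)) := by
  have hins := (hL m).2 j t ht (proj y)
  have hX : E.X m t ((j : ℝ) * E.refresh (m + 1)) (proj y) =
      proj (evolutionMap (fun t (z : EuclideanSpace ℝ (Fin 3)) => E.partialSum m t (proj z)) ((j : ℝ) * E.refresh (m + 1)) t y) := by
    rw [LagrangianLatticeCarrier.X_apply, evolutionMap_partialSum_apply E m (hL m).1 h1 h3a h3b hF1a, proj_add]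
  rw [hX] at hins
  rw [fderiv_evolutionMap_partialSum E m (hL m).1 h1 h3a h3b hF1a hF1b]
  exact hins

/-- The lifted coarse field of level `m+1` splits off the last level: `B_{m+1}(r, z) = B_m(r, z) + b (m+1) r (proj z)`. [folklore] -/
theorem partialSum_succ_apply (E : LagrangianLatticeCarrier k) (m : ℕ) (r : ℝ) (x : UnitAddTorus (Fin 3)) :
    E.partialSum (m + 1) r x = E.partialSum m r x + E.b (m + 1) r x := by
  unfold LagrangianLatticeCarrier.partialSum
  rw [Finset.sum_range_succ]

/-! ## The window conjugation identity -/

/-- **Window conjugation identity.** For `s, t` in one refresh window `[w, w + R_{m+1})` of level `m+1`,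
`Φ_{m+1}(s→t) = Φ_m(w→t) ∘ Ψ_{m+1}(s→t) ∘ Φ_m(s→w)`, where `Ψ_{m+1}` is the evolution of the lifted Eulerian level `m+1`.
[cite: ArmstrongVicol2025, §2.2 (PDF p. 18: X_m the flow of b_{≤m} = b_{≤m−1} + (X_{m−1})_* v_m on the windows) and §5.1] -/
theorem evolutionMap_partialSum_succ_eq_conj (E : LagrangianLatticeCarrier k) (m : ℕ) (hL : E.IsLagrangian)
    (h1 : ∀ m, Continuous (uncurry (E.b (m + 1)))) (h3a : ∀ m t, IsSmooth (E.b (m + 1) t))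
    (h3b : ∀ m (n : ℕ), ∃ C : ℝ, ∀ t y, ‖iteratedFDeriv ℝ n (Torus.lift (E.b (m + 1) t)) y‖ ≤ C)
    (hF1a : ∀ m s, Continuous fun p : ℝ × UnitAddTorus (Fin 3) => E.disp m p.1 s p.2)
    (hF1b : ∀ m t s, IsSmooth (E.disp m t s)) (j : ℤ) {s t : ℝ} (hs : s ∈ E.window (m + 1) j)
    (ht : t ∈ E.window (m + 1) j) (z : EuclideanSpace ℝ (Fin 3)) :
    evolutionMap (fun t (z : EuclideanSpace ℝ (Fin 3)) => E.partialSum (m + 1) t (proj z)) s t z =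
      evolutionMap (fun t (z : EuclideanSpace ℝ (Fin 3)) => E.partialSum m t (proj z)) ((j : ℝ) * E.refresh (m + 1)) t
        (evolutionMap (fun t (z : EuclideanSpace ℝ (Fin 3)) => E.toFractalCarrierData.level (m + 1) t (proj z)) s t
          (evolutionMap (fun t (z : EuclideanSpace ℝ (Fin 3)) => E.partialSum m t (proj z)) s ((j : ℝ) * E.refresh (m + 1)) z)) := by
  set Bm : ℝ → EuclideanSpace ℝ (Fin 3) → EuclideanSpace ℝ (Fin 3) := fun t z => E.partialSum m t (proj z) with hBm
  set Bm1 : ℝ → EuclideanSpace ℝ (Fin 3) → EuclideanSpace ℝ (Fin 3) := fun t z => E.partialSum (m + 1) t (proj z) with hBm1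
  set v : ℝ → EuclideanSpace ℝ (Fin 3) → EuclideanSpace ℝ (Fin 3) := fun t z => E.toFractalCarrierData.level (m + 1) t (proj z) with hv
  set w : ℝ := (j : ℝ) * E.refresh (m + 1) with hw
  have hB : IsUniformlyLipschitzOn Bm univ := isUniformlyLipschitzOn_partialSum_proj E h1 h3a h3b m
  have hB1 : IsUniformlyLipschitzOn Bm1 univ := isUniformlyLipschitzOn_partialSum_proj E h1 h3a h3b (m + 1)
  have hvU : IsUniformlyLipschitzOn v univ := isUniformlyLipschitzOn_level_proj E.toFractalCarrierData (m + 1)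
  set p := evolutionMap Bm s w z with hp
  -- the candidate integral curve of `B_{m+1}` through `z` at time `s`
  set γ : ℝ → EuclideanSpace ℝ (Fin 3) := fun r => evolutionMap Bm w r (evolutionMap v s r p) with hγ
  -- joint continuity of `(r, y) ↦ B_m(r, Φ_m(w→r) y)`
  have hBc : Continuous (uncurry Bm) := by
    have h := hB.continuousOn_uncurry convex_univ
    rwa [univ_prod_univ, continuousOn_univ] at h
  have hΦc := continuous_evolutionMap_partialSum_uncurry E m (hL m).1 h1 h3a h3b hF1a w
  have hWc : Continuous fun q : ℝ × EuclideanSpace ℝ (Fin 3) => Bm q.1 (evolutionMap Bm w q.1 q.2) :=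
    hBc.comp (continuous_fst.prodMk hΦc)
  -- the curve solves the equation of `B_{m+1}` on the window
  have hderiv : ∀ r ∈ E.window (m + 1) j, HasDerivAt γ (Bm1 r (γ r)) r := by
    intro r hr
    have hΦ : ∀ y r, HasDerivAt (fun r => evolutionMap Bm w r y) (Bm r (evolutionMap Bm w r y)) r := fun y r =>
      hasDerivAt_evolutionMap_univ hB w r y
    have hz : HasDerivAt (fun r => evolutionMap v s r p) (v r (evolutionMap v s r p)) r := hasDerivAt_evolutionMap_univ hvU s r p
    have hA : HasFDerivAt (evolutionMap Bm w r) (fderiv ℝ (evolutionMap Bm w r) (evolutionMap v s r p)) (evolutionMap v s r p) :=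
      ((differentiable_evolutionMap_partialSum E m (hL m).1 h1 h3a h3b hF1a hF1b w r) _).hasFDerivAt
    have h := Summit.AnomalousDissipation.AnomalousDissipation.Theorems.SolenoidalFractalHomogenisation.LagrangianCarrier.hasDerivAt_comp_curve
      (Φ := fun r y => evolutionMap Bm w r y) (W := fun r y => Bm r (evolutionMap Bm w r y)) hΦ hz hWc.continuousAt hA
    refine h.congr_deriv ?_
    -- the derivative is `B_m(r, γ r) + DΦ_m(w→r)(ζ) v(r, ζ) = B_{m+1}(r, γ r)` by the insertion
    have hinsert := b_succ_proj_evolutionMap E m hL h1 h3a h3b hF1a hF1b j hr (evolutionMap v s r p)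
    show Bm r (evolutionMap Bm w r (evolutionMap v s r p)) +
        fderiv ℝ (evolutionMap Bm w r) (evolutionMap v s r p) (v r (evolutionMap v s r p)) = Bm1 r (γ r)
    rw [hBm1, hγ]
    simp only
    rw [partialSum_succ_apply, hinsert]
  have hwithin : ∀ r ∈ E.window (m + 1) j, HasDerivWithinAt γ (Bm1 r (γ r)) (E.window (m + 1) j) r := fun r hr =>
    (hderiv r hr).hasDerivWithinAt
  have huniq := (hB1.mono (subset_univ _)).eq_evolutionMap (convex_Ico _ _) hs hwithin ht
  -- initial value: `γ s = z`
  have hγs : γ s = z := by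
    rw [hγ]
    simp only
    rw [evolutionMap_self, hp, evolutionMap_symm_univ hB s w z]
  rw [hγs] at huniq
  rw [← huniq]

end Summit.AnomalousDissipation.AnomalousDissipation.Theorems.SolenoidalFractalHomogenisation.LagrangianCarrierConstruction

end
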